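import Literature.IUT.HodgeArakelov.MonoThetaProjectiveR
import Literature.IUT.HodgeArakelov.Def11OutputTransport
import Mathlib.CategoryTheory.CofilteredSystem
import Mathlib.Data.Nat.Factorial.Basic

/-!
# [IUTchII] Prop. 1.5 (i) — discrete rigidity of projective systems of mono-theta environments,
# over the FULL index set `ℕ_{≥1}`, from [EtTh] Cor. 2.18 (iv) read at the models (proof-only companion)

PROOF-ONLY companion (theorems only; no `def`, no new named fact) of the landed, frozen
`MonoThetaProjective.lean` (abc-iut-L6-t1, p407497) and its repair-of-record `MonoThetaProjectiveR.lean`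
(abc-iut-L6-t19, p409904). abc-iut cell, wave-4 seat abc-iut-w4-d038, DAG node **IUTchII:Prop1.5(i)**.
S. Mochizuki, *Inter-universal Teichmüller theory II*, kurims manuscript (Dec. 2020), §1, Prop. 1.5 (i)
p. 29 l. 18: "Such a projective system is uniquely determined, up to isomorphism, by `X̲̲_k` [cf. Remark
1.5.1 below; the discrete rigidity property of [EtTh], Corollary 2.19, (ii)]" [claim: Mochizuki2012,
status: disputed] (IUTchII §1 Prop 1.5 (i), kurims p.29); [EtTh] = S. Mochizuki, *The étale theta
function …*, Publ. RIMS **45** (2009), Cor. 2.18 (iv) pp. 61–63, Cor. 2.19 (ii) p. 64, proof p. 66: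
"Assertion (ii) follows immediately from Corollary 2.18, (iv). … assertion (ii) may be thought of as a
consequence of the fact that the '`R¹lim`'s of the projective system '`{Hom(ℤ/2ℤ, ℤ/Nℤ)}_{N ∈ E}`' of
Corollary 2.18, (iv), as well as the projective system '`{μ_N}_{N∈E}`', vanish." (quotation as transcribed
in the tree's `EtaleTheta/Discharge/Sec2DiscreteRigidityProofs.lean`, abc-iut-L2-d1)
[cite: MochizukiEtTh2009, Cor 2.19(ii) p.64].

## What is proved

`MonoThetaProjSystem.prop15_i'_of_cor218_iv`: for EVERY model family `F` with model reductions `R`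
(the frozen interfaces `ModelFamily`, `ModelFamily.Reductions`), the repaired node statement
`Prop15_i' R A B` holds for ALL projective systems `A`, `B` — i.e. any two projective systems of mono-theta
environments whose transition maps are morphisms of mono-theta environments (`IsMonoThetaCompatible`) are
isomorphic by a compatible family of isomorphisms of mono-theta environments (`Prop15_i A B`) — PROVIDED the
model family satisfies the following three clauses of [EtTh] Cor. 2.18 (iv) (PARAPHRASE, not a quotation: the
mod-`M` quotient gives a natural homomorphism `Aut(𝕄_{M'}) → Aut(𝕄_M)`, a bijection when `M'/M` is odd, whose
kernel and cokernel are in general those of `Hom(ℤ/2ℤ, μ_{M'}) → Hom(ℤ/2ℤ, μ_M)`; the tree's typings are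
`ThetaEnvTower.Cor218_iv_reduction`, `Cor218_iv_bijective_of_odd`, `ThetaEnvData.Cor218_iv_surjective`,
`ThetaEnvData.Cor218_iv_fibre`), read at the MODELS and taken as explicit hypotheses (no `def`):

* `hred`  — REDUCTION: every automorphism of the mod-`M'` model mono-theta environment induces, along the
  model reduction `red_{M',M}`, an automorphism of the mod-`M` model (`M ∣ M'`) — the tree's L2 form is
  `EtaleTheta.ThetaEnvTower.Cor218_iv_reduction`, PROVED for the [EtTh] §1 model tower by abc-iut-L2
  (`DoubleUnderline.cor218_iv_reduction_model`);
* `hlift` — SURJECTIVITY at `1 ∣ M`: every automorphism of the mod-`1` model lifts to the mod-`M` model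
  (cokernel `= coker(Hom(ℤ/2,μ_M) → Hom(ℤ/2,μ_1)) = 0`; L2 form `ThetaEnvData.Cor218_iv_surjective`);
* `hfin`  — FINITE FIBRE over the identity: only finitely many automorphisms of the mod-`M` model induce the
  identity of the mod-`1` model (the fibre is `{μ_M-conjugates} × Hom(Π_Y/Π_Ÿ, μ_M)`; L2 form
  `ThetaEnvData.Cor218_iv_fibre`, a THEOREM of abc-iut-L2-t10 `cor218_iv_fibre_of_prop214_i`).

So this is a CONDITIONAL discharge of IUTchII:Prop1.5(i) modulo exactly the cited [EtTh] Cor. 2.18 (iv)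
clauses, in the same currency as the L2 discharge of [EtTh] Cor. 2.19 (ii) itself
(`EtaleTheta/Discharge/Sec2DiscreteRigidityProofs.lean`, `ThetaEnvTower.cor219_ii_of`). What it adds to the
tree: (1) the L6 ENCODING (arbitrary environments with `MonoThetaEnv.Iso`s to the models, systems indexed by
ALL of `ℕ_{≥1}` under divisibility — [IUTchII] p. 29 "the index `M` of the projective system varies
multiplicatively among the elements of `ℕ_{≥1}`") is reduced to the models-with-twisted-transitions normal form; (2) the INDEX-SET GAP
between the two typings is closed: L2's `Cor219_ii` is typed over a cofinal TOTALLY ORDERED `E ⊆ ℕ_{≥1}`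
([EtTh] Prop. 2.15), whereas Prop. 1.5 quantifies over the directed poset `(ℕ_{≥1}, ∣)`; here the printed
"`R¹ lim` vanishes" argument is run (Kőnig / `nonempty_sections_of_finite_inverse_system`) on the cofinal
chain `M! ∣ M'!` and the resulting isomorphisms are pushed to every `M ∣ M!` by functoriality, which is
legitimate precisely because descent along the reductions is unique (`red` onto).

Route (all inside the proof of the one theorem; auxiliary lemmas are about the frozen interfaces only):
reference isomorphisms `a_M : A_M ⥲ 𝕄_M` turn each transition into a twisted model reduction
`v_h ∘ red_h` (`v_h ∈ Aut(𝕄_M)`, by `hred`); `trans_comp` gives the cocycle identity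
`v_{hh'} ∘ red_{hh'} = v_h ∘ red_h ∘ v_{h'} ∘ red_{h'}`; the admissible level-`M` corrections form the set
`S_M = {x ∈ Aut(𝕄_M) | v^B_{1,M} ∘ red_{1,M} ∘ x = v^A_{1,M} ∘ red_{1,M}}`, NONEMPTY by `hlift`, FINITE by
`hfin` (a coset of the fibre), and mapped `S_{M'} → S_M` by `x ↦ v^B_h ∘ desc_h(x) ∘ (v^A_h)⁻¹`
functorially; a compatible choice `ε_M ∈ S_M` exists (inverse limit of nonempty finite sets); then
`e_M := (a^B_M)⁻¹ ∘ ε_M ∘ a^A_M` is the required compatible family. The remaining sub-items (ii)–(iv) of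
Prop. 1.5 are OUTPUT/interface predicates of the frozen file (`transitionsAreIsos` on the free datum
`transX`, `Nonempty (ThetaEnvData _)` over the Prop. 1.4 cohomology interface, the equation
`Prop15_iv_compatible`) and are dischargeable only at the genuine instance — an `ℕ_{≥1}`-indexed
`ModelFamily` built from abc-iut-L2's per-level `DoubleUnderline.thetaEnvData` (HOME/plan/L6/MERGE-MAP.md,
row `ModelFamily`: WAIT(L2-t2 follow-up)); they are NOT touched here.

COMPANIONS (same node): abc-iut-w4-d030's `MonoThetaProjectiveChainProofs.lean` (`prop15_i'_of_chainRigidity`: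
the route through [EtTh] Cor. 2.19 (ii) along one cofinal chain + the reduction clause; `Prop15_i` is an
equivalence relation) and `MonoThetaProjectiveBridgeEtThProofs.lean` (`EtaleLevels.prop15_i'_etaleLevels`: the
three clauses `hred`/`hlift`/`hfin` below PROVED at the GENUINE models of an [EtTh] §1 theta setting, so that
this theorem closes the node there modulo temp-slimness of `Π^tp_X`, openness of `Π^tp_X → G_K` and the level
facts `ThetaEnvData.Cor218_iv_surjective` / `ThetaEnvData.Cor218_iv_fibre`).

HONEST FRAMING: conditional discharge modulo the named [EtTh] clauses; the claim key `Mochizuki2012` is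
DISPUTED (D-0012); nothing here takes a side on [IUTchIII] Cor. 3.12; typed ≠ discharged elsewhere.
-/

namespace Literature.IUT.HodgeArakelov

universe u

open CategoryTheory Opposite

variable {S : ThetaSetting.{u}}

/-! ## Bookkeeping on isomorphisms of mono-theta environments (frozen interface `MonoThetaEnv.Iso`) -/

namespace MonoThetaEnv.Iso

/-- Two isomorphisms of mono-theta environments with the same underlying map coincide (the remaining
fields are propositions). [cite: MochizukiEtTh2009, Def 2.13(ii) p.48] -/
theorem eq_of_iso_apply_eq {M M' : MonoThetaEnv S} {α β : MonoThetaEnv.Iso M M'}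
    (h : ∀ x, α.iso x = β.iso x) : α = β := by
  obtain ⟨a, _, _⟩ := α
  obtain ⟨b, _, _⟩ := β
  have hab : a = b := ContinuousMulEquiv.ext h
  subst hab
  rfl

/-- Underlying map of a composite (`Def11OutputTransport`'s `Iso.trans`).
[cite: MochizukiEtTh2009, Def 2.13(ii) p.48] -/
@[simp] theorem trans_iso_apply {M M' M'' : MonoThetaEnv S} (α : MonoThetaEnv.Iso M M')
    (β : MonoThetaEnv.Iso M' M'') (x : M.Pi) : (α.trans β).iso x = β.iso (α.iso x) := rfl

/-- Underlying map of an inverse (`Def11OutputTransport`'s `Iso.symm`).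
[cite: MochizukiEtTh2009, Def 2.13(ii) p.48] -/
@[simp] theorem symm_iso_apply {M M' : MonoThetaEnv S} (α : MonoThetaEnv.Iso M M') (x : M'.Pi) :
    α.symm.iso x = α.iso.symm x := rfl

end MonoThetaEnv.Iso

/-! ## Prop. 1.5 (i) from [EtTh] Cor. 2.18 (iv) read at the models -/

namespace MonoThetaProjSystem

variable {F : ModelFamily S}

/-- **IUTchII:Prop1.5(i)′ — DISCHARGED modulo [EtTh] Cor. 2.18 (iv) read at the models** (kurims p. 29:
"Such a projective system [of mono-theta environments] is uniquely determined, up to isomorphism, by `X̲̲_k`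
[… the discrete rigidity property of [EtTh], Corollary 2.19, (ii)]"): for every model family `F` with model
reductions `R` satisfying the Cor. 2.18 (iv) clauses `hred` (reduction of automorphisms `Aut(𝕄_{M'}) →
Aut(𝕄_M)`), `hlift` (lifting `Aut(𝕄_1) → Aut(𝕄_M)`) and `hfin` (finitely many automorphisms of `𝕄_M` over
the identity of `𝕄_1`), ANY two projective systems of mono-theta environments indexed by all of `ℕ_{≥1}`
whose transitions are morphisms of mono-theta environments are isomorphic by a compatible family of
isomorphisms of mono-theta environments — the repaired node statement `Prop15_i'` of
`MonoThetaProjectiveR`, for all `A`, `B`. Route = the printed "`R¹ lim` vanishes" argument on the cofinal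
chain `M! ∣ M'!`, pushed to every index by the uniqueness of descent (module docstring).
[claim: Mochizuki2012, status: disputed] (IUTchII §1 Prop 1.5 (i), kurims p.29)
[cite: MochizukiEtTh2009, Cor 2.19(ii) p.64] -/
theorem prop15_i'_of_cor218_iv (R : F.Reductions)
    (hred : ∀ (M M' : ℕ+) (h : (M : ℕ) ∣ (M' : ℕ))
      (φ' : MonoThetaEnv.Iso (F.modelEnv M') (F.modelEnv M')),
      ∃ φ : MonoThetaEnv.Iso (F.modelEnv M) (F.modelEnv M), ∀ x, R.red h (φ'.iso x) = φ.iso (R.red h x))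
    (hlift : ∀ (M : ℕ+) (φ : MonoThetaEnv.Iso (F.modelEnv 1) (F.modelEnv 1)),
      ∃ ψ : MonoThetaEnv.Iso (F.modelEnv M) (F.modelEnv M),
        ∀ x, R.red (PNat.dvd_iff.mp (one_dvd M)) (ψ.iso x) =
          φ.iso (R.red (PNat.dvd_iff.mp (one_dvd M)) x))
    (hfin : ∀ M : ℕ+, Set.Finite {φ : MonoThetaEnv.Iso (F.modelEnv M) (F.modelEnv M) |
      ∀ x, R.red (PNat.dvd_iff.mp (one_dvd M)) (φ.iso x) = R.red (PNat.dvd_iff.mp (one_dvd M)) x})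
    (A B : MonoThetaProjSystem F) : Literature.IUT.HodgeArakelov.Prop15_i' R A B := by
  intro hA hB
  classical
  have h1 : ∀ M : ℕ+, ((1 : ℕ+) : ℕ) ∣ (M : ℕ) := fun M => PNat.dvd_iff.mp (one_dvd M)
  /- STEP 0: reference isomorphisms to the models. -/
  have exA : ∀ M : ℕ+, ∃ _ : MonoThetaEnv.Iso (A.env M) (F.modelEnv M), True := fun M => by
    obtain ⟨-, i, -⟩ := hA M M (dvd_refl _)
    exact ⟨i, trivial⟩
  have exB : ∀ M : ℕ+, ∃ _ : MonoThetaEnv.Iso (B.env M) (F.modelEnv M), True := fun M => by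
    obtain ⟨-, i, -⟩ := hB M M (dvd_refl _)
    exact ⟨i, trivial⟩
  choose aA _hA0 using exA
  choose aB _hB0 using exB
  /- STEP 1: the transitions, read through the reference isomorphisms, are twisted model reductions
  `v_h ∘ red_h` (by `hred`). -/
  have twist : ∀ (C : MonoThetaProjSystem F), C.IsMonoThetaCompatible R →
      ∀ (a : ∀ M, MonoThetaEnv.Iso (C.env M) (F.modelEnv M)) (M M' : ℕ+) (h : (M : ℕ) ∣ (M' : ℕ)),
      ∃ v : MonoThetaEnv.Iso (F.modelEnv M) (F.modelEnv M),
        ∀ y, (a M).iso (C.trans h y) = v.iso (R.red h ((a M').iso y)) := by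
    intro C hC a M M' h
    obtain ⟨i', i, hi⟩ := hC M M' h
    obtain ⟨d, hd⟩ := hred M M' h ((a M').symm.trans i')
    refine ⟨d.trans (i.symm.trans (a M)), fun y => ?_⟩
    have e1 : C.trans h y = i.iso.symm (R.red h (i'.iso y)) := by
      rw [← hi y, ContinuousMulEquiv.symm_apply_apply]
    have e2 := hd ((a M').iso y)
    simp only [MonoThetaEnv.Iso.trans_iso_apply, MonoThetaEnv.Iso.symm_iso_apply,
      ContinuousMulEquiv.symm_apply_apply] at e2
    show (a M).iso (C.trans h y) = (a M).iso (i.iso.symm (d.iso (R.red h ((a M').iso y))))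
    rw [e1, e2]
  choose vA hvA using twist A hA aA
  choose vB hvB using twist B hB aB
  /- STEP 2: `v` at `M ∣ M` is the identity; the cocycle identity from `trans_comp`; its shadow at level 1. -/
  have vrefl : ∀ (C : MonoThetaProjSystem F) (a : ∀ M, MonoThetaEnv.Iso (C.env M) (F.modelEnv M))
      (v : ∀ M M' : ℕ+, (M : ℕ) ∣ (M' : ℕ) → MonoThetaEnv.Iso (F.modelEnv M) (F.modelEnv M)),
      (∀ (M M' : ℕ+) (h : (M : ℕ) ∣ (M' : ℕ)) y,
        (a M).iso (C.trans h y) = (v M M' h).iso (R.red h ((a M').iso y))) →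
      ∀ (M : ℕ+) (h : (M : ℕ) ∣ (M : ℕ)) (w : F.modelPi M), (v M M h).iso w = w := by
    intro C a v hv M h w
    obtain ⟨y, rfl⟩ : ∃ y, (a M).iso y = w := ⟨(a M).iso.symm w, by simp⟩
    have e := hv M M h y
    rw [C.trans_refl, R.red_refl] at e
    exact e.symm
  have cocycle : ∀ (C : MonoThetaProjSystem F) (a : ∀ M, MonoThetaEnv.Iso (C.env M) (F.modelEnv M))
      (v : ∀ M M' : ℕ+, (M : ℕ) ∣ (M' : ℕ) → MonoThetaEnv.Iso (F.modelEnv M) (F.modelEnv M)),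
      (∀ (M M' : ℕ+) (h : (M : ℕ) ∣ (M' : ℕ)) y,
        (a M).iso (C.trans h y) = (v M M' h).iso (R.red h ((a M').iso y))) →
      ∀ (M M' M'' : ℕ+) (h : (M : ℕ) ∣ (M' : ℕ)) (h' : (M' : ℕ) ∣ (M'' : ℕ)) (z : F.modelPi M''),
        (v M M'' (h.trans h')).iso (R.red (h.trans h') z) =
          (v M M' h).iso (R.red h ((v M' M'' h').iso (R.red h' z))) := by
    intro C a v hv M M' M'' h h' z
    obtain ⟨y, rfl⟩ : ∃ y, (a M'').iso y = z := ⟨(a M'').iso.symm z, by simp⟩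
    rw [← hv M M'' (h.trans h') y, ← C.trans_comp h h' y, hv M M' h, hv M' M'' h']
  have shadow : ∀ (C : MonoThetaProjSystem F) (a : ∀ M, MonoThetaEnv.Iso (C.env M) (F.modelEnv M))
      (v : ∀ M M' : ℕ+, (M : ℕ) ∣ (M' : ℕ) → MonoThetaEnv.Iso (F.modelEnv M) (F.modelEnv M)),
      (∀ (M M' : ℕ+) (h : (M : ℕ) ∣ (M' : ℕ)) y,
        (a M).iso (C.trans h y) = (v M M' h).iso (R.red h ((a M').iso y))) →
      ∀ (M M' : ℕ+) (h : (M : ℕ) ∣ (M' : ℕ)) (w : F.modelPi M),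
        (v 1 M (h1 M)).iso (R.red (h1 M) ((v M M' h).iso w)) =
          (v 1 M' (h1 M')).iso (R.red (h1 M) w) := by
    intro C a v hv M M' h w
    obtain ⟨z, rfl⟩ := R.red_surjective h w
    rw [← cocycle C a v hv 1 M M' (h1 M) h z, R.red_comp]
  /- STEP 3: the descent-twist maps `f_h : Aut(𝕄_{M'}) → Aut(𝕄_M)`, `x ↦ v^B_h ∘ desc_h(x) ∘ (v^A_h)⁻¹`,
  characterised by their values on `v^A_h (red_h z)`; functoriality. -/
  have exf : ∀ (M M' : ℕ+) (h : (M : ℕ) ∣ (M' : ℕ))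
      (x : MonoThetaEnv.Iso (F.modelEnv M') (F.modelEnv M')),
      ∃ y : MonoThetaEnv.Iso (F.modelEnv M) (F.modelEnv M),
        ∀ z, y.iso ((vA M M' h).iso (R.red h z)) = (vB M M' h).iso (R.red h (x.iso z)) := by
    intro M M' h x
    obtain ⟨d, hd⟩ := hred M M' h x
    refine ⟨((vA M M' h).symm.trans d).trans (vB M M' h), fun z => ?_⟩
    simp only [MonoThetaEnv.Iso.trans_iso_apply, MonoThetaEnv.Iso.symm_iso_apply,
      ContinuousMulEquiv.symm_apply_apply, hd]
  choose f hf using exf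
  have funiq : ∀ (M M' : ℕ+) (h : (M : ℕ) ∣ (M' : ℕ))
      (y₁ y₂ : MonoThetaEnv.Iso (F.modelEnv M) (F.modelEnv M)),
      (∀ z, y₁.iso ((vA M M' h).iso (R.red h z)) = y₂.iso ((vA M M' h).iso (R.red h z))) → y₁ = y₂ := by
    intro M M' h y₁ y₂ hy
    apply MonoThetaEnv.Iso.eq_of_iso_apply_eq
    intro w
    obtain ⟨z, hz⟩ := R.red_surjective h ((vA M M' h).iso.symm w)
    have hw : (vA M M' h).iso (R.red h z) = w := by rw [hz, ContinuousMulEquiv.apply_symm_apply]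
    rw [← hw]
    exact hy z
  have f_refl : ∀ (M : ℕ+) (h : (M : ℕ) ∣ (M : ℕ)) (x : MonoThetaEnv.Iso (F.modelEnv M) (F.modelEnv M)),
      f M M h x = x := by
    intro M h x
    refine funiq M M h _ _ fun z => ?_
    rw [hf, vrefl A aA vA hvA, vrefl B aB vB hvB, R.red_refl, R.red_refl]
  have f_comp : ∀ (M M' M'' : ℕ+) (h : (M : ℕ) ∣ (M' : ℕ)) (h' : (M' : ℕ) ∣ (M'' : ℕ))
      (x : MonoThetaEnv.Iso (F.modelEnv M'') (F.modelEnv M'')),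
      f M M'' (h.trans h') x = f M M' h (f M' M'' h' x) := by
    intro M M' M'' h h' x
    refine funiq M M'' (h.trans h') _ _ fun z => ?_
    rw [hf, cocycle A aA vA hvA M M' M'' h h', hf, hf, ← cocycle B aB vB hvB M M' M'' h h']
  /- STEP 4: the admissible corrections `S_M` (a coset of the fibre over the identity): nonempty by
  `hlift`, finite by `hfin`, preserved by the `f_h`. -/
  set SS : ∀ M : ℕ+, Set (MonoThetaEnv.Iso (F.modelEnv M) (F.modelEnv M)) := fun M =>
    {x | ∀ z, (vB 1 M (h1 M)).iso (R.red (h1 M) (x.iso z)) = (vA 1 M (h1 M)).iso (R.red (h1 M) z)}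
    with hSS
  have hSne : ∀ M, (SS M).Nonempty := by
    intro M
    obtain ⟨ψ, hψ⟩ := hlift M ((vA 1 M (h1 M)).trans (vB 1 M (h1 M)).symm)
    refine ⟨ψ, fun z => ?_⟩
    have e := hψ z
    simp only [MonoThetaEnv.Iso.trans_iso_apply, MonoThetaEnv.Iso.symm_iso_apply] at e
    show (vB 1 M (h1 M)).iso (R.red (h1 M) (ψ.iso z)) = (vA 1 M (h1 M)).iso (R.red (h1 M) z)
    rw [e, ContinuousMulEquiv.apply_symm_apply]
  have hSfin : ∀ M, (SS M).Finite := by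
    intro M
    obtain ⟨x₀, hx₀⟩ := hSne M
    refine ((hfin M).image fun k => k.trans x₀).subset fun x hx => ?_
    refine ⟨x.trans x₀.symm, fun z => ?_, ?_⟩
    · simp only [MonoThetaEnv.Iso.trans_iso_apply, MonoThetaEnv.Iso.symm_iso_apply]
      apply (vA 1 M (h1 M)).iso.injective
      have e0 := hx₀ (x₀.iso.symm (x.iso z))
      rw [ContinuousMulEquiv.apply_symm_apply] at e0
      rw [← e0]
      exact hx z
    · exact MonoThetaEnv.Iso.eq_of_iso_apply_eq fun z => by simp
  have hSmap : ∀ (M M' : ℕ+) (h : (M : ℕ) ∣ (M' : ℕ)) (x : MonoThetaEnv.Iso (F.modelEnv M') (F.modelEnv M')),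
      x ∈ SS M' → f M M' h x ∈ SS M := by
    intro M M' h x hx w
    obtain ⟨z, hz⟩ := R.red_surjective h ((vA M M' h).iso.symm w)
    have hw : (vA M M' h).iso (R.red h z) = w := by rw [hz, ContinuousMulEquiv.apply_symm_apply]
    rw [← hw, hf, shadow B aB vB hvB M M' h, R.red_comp, hx z, ← R.red_comp (h1 M) h z,
      ← shadow A aA vA hvA M M' h]
  /- STEP 5: Kőnig on the cofinal chain `k ↦ k!`: a compatible choice `ε_{k!} ∈ S_{k!}`. -/
  have hcpos : ∀ k : ℕ, 0 < k.factorial := Nat.factorial_pos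
  let c : ℕ → ℕ+ := fun k => ⟨k.factorial, hcpos k⟩
  have hc : ∀ {k k' : ℕ}, k ≤ k' → ((c k : ℕ+) : ℕ) ∣ ((c k' : ℕ+) : ℕ) := fun hk =>
    Nat.factorial_dvd_factorial hk
  have hcof : ∀ M : ℕ+, (M : ℕ) ∣ ((c M : ℕ+) : ℕ) := fun M => Nat.dvd_factorial M.pos le_rfl
  let Fn : ℕᵒᵖ ⥤ Type u :=
    { obj := fun j => ↥(SS (c j.unop))
      map := fun {j j'} g => TypeCat.ofHom fun x =>
        ⟨f (c j'.unop) (c j.unop) (hc (leOfHom g.unop)) x.1, hSmap _ _ _ _ x.2⟩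
      map_id := fun j => ConcreteCategory.hom_ext _ _ fun x => Subtype.ext (f_refl _ _ _)
      map_comp := fun g g' => ConcreteCategory.hom_ext _ _ fun x => Subtype.ext (f_comp _ _ _ _ _ _) }
  haveI : ∀ j : ℕᵒᵖ, Finite (Fn.obj j) := fun j => (hSfin (c j.unop)).to_subtype
  haveI : ∀ j : ℕᵒᵖ, Nonempty (Fn.obj j) := fun j => by
    obtain ⟨x, hx⟩ := hSne (c j.unop)
    exact ⟨⟨x, hx⟩⟩
  obtain ⟨sec, hsec⟩ := nonempty_sections_of_finite_inverse_system Fn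
  /- STEP 6: push the choice to every index `M ∣ M!`; compatibility along all of `(ℕ_{≥1}, ∣)`. -/
  let ε : ∀ M : ℕ+, MonoThetaEnv.Iso (F.modelEnv M) (F.modelEnv M) := fun M =>
    f M (c M) (hcof M) (sec (op (M : ℕ))).1
  have hε : ∀ (M M' : ℕ+) (h : (M : ℕ) ∣ (M' : ℕ)), ε M = f M M' h (ε M') := by
    intro M M' h
    have hle : (M : ℕ) ≤ (M' : ℕ) := Nat.le_of_dvd M'.pos h
    have hs : f (c M) (c M') (hc hle) (sec (op (M' : ℕ))).1 = (sec (op (M : ℕ))).1 := by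
      have := hsec (homOfLE hle).op
      exact congrArg Subtype.val this
    show f M (c M) (hcof M) (sec (op (M : ℕ))).1 = f M M' h (f M' (c M') (hcof M') (sec (op (M' : ℕ))).1)
    rw [← hs, ← f_comp, ← f_comp]
  /- STEP 7: the compatible family of isomorphisms `e_M := (a^B_M)⁻¹ ∘ ε_M ∘ a^A_M`. -/
  refine ⟨fun M => (aA M).trans ((ε M).trans (aB M).symm), fun {M M'} h x => ?_⟩
  simp only [MonoThetaEnv.Iso.trans_iso_apply, MonoThetaEnv.Iso.symm_iso_apply]
  apply (aB M).iso.injective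
  rw [ContinuousMulEquiv.apply_symm_apply, hvA M M' h x, hvB M M' h, ContinuousMulEquiv.apply_symm_apply,
    hε M M' h]
  exact hf M M' h (ε M') ((aA M').iso x)

end MonoThetaProjSystem

end Literature.IUT.HodgeArakelov
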